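import Summits.ResolutionOfSingularities.ResolutionOfSingularities.Theorems.EquisingularLiftEquisingularLiftNatMultiOrdinaryPoints
import Summits.ResolutionOfSingularities.ResolutionOfSingularities.Theorems.EquisingularLiftEquisingularLiftNatOneStepVertexChart
import HarnessLib

/-!
# [OURS · L1 W4.5(b)] EL♮ FOR EVERY HYPERSURFACE WHOSE SINGULAR POINTS ARE ONE-STEP POINTS AT COORDINATE VERTICES, EVERY DIMENSION — T-ONESTEP:
# isolated singular points resolved by one blow-up, certified by the Jacobian criterion on the explicit strict-transform polynomials
# (crux `Theses.EquisingularLift.EquisingularLiftNat`, stmt-ResolutionOfSingularities-20038)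

NOT a statement of any manuscript; OURS kernel theorem (cell `res-hironaka`, chain w45b; seat res-D-pv-013, own initiative, counted 0). AI-written,
weaker than expert review. No definition, no `sorry`, standard axioms.

T-MULTIORD (`MultiOrd.elNatAt_ordinaryPoints`, p554227) asks the marked vertices to be ORDINARY multiple points (nonsingular tangent cone). Here the
tangent cone may be singular: the vertex `P_c` is a ONE-STEP POINT if, with `F(x_c := 1) = Φ + Ψ` (`Φ ≠ 0` the tangent cone of degree `μ ≥ 1`,
`Ψ ∈ (y)^{μ+1}`), for every chart direction `l` the explicit strict transform `G_l` (`(Φ+Ψ)(T_l, T_lT_j) = T_l^μ · G_l`) satisfies the Jacobian criterion at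
the primes containing `T_l` — e.g. `A₂` points `y₀y₁ + y₂³ (+ y₃² + …)`. With the multi-point rung, the product-of-centres regularity and the Jacobian
criterion off the vertices exactly as in T-MULTIORD:

* `OneStep.isRegularLocalRing_localization_blowupAlgebra_chartRing` — the criterion transported to `ChartRing F c` (any vertex `c`);
* `OneStep.isRegularLocalRing_stalk_of_isBlowup_comap` — every blow-up of `H` along the point `P_c` is regular at the points over it;
* **`OneStep.elNatAt_oneStepPoints`** — EL♮ for every hypersurface whose singular points are one-step points at coordinate vertices (any number, any `n`, any `p`).

First specimen (next file): the `3A₂` cubic surface `x₀x₁x₂ + x₃³ = 0`, every characteristic.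

References: Görtz–Wedhorn I Prop. 13.96; The Stacks Project 080A, 0804, 0BIQ; Matsumura Thm. 14.2 — through the cited tree files.
-/

set_option linter.dupNamespace false -- mandated namespace `Summit.<Summit>.<Problem>` of this single-conjunct summit

noncomputable section

open CategoryTheory CategoryTheory.Limits AlgebraicGeometry TopologicalSpace
open MvPolynomial HomogeneousLocalization
open Literature.AlgebraicGeometry.Resolution
open Literature.AlgebraicGeometry.Motives Literature.AlgebraicGeometry.Motives.SmoothHypersurface
open Literature.AlgebraicGeometry.Motives.ProjectiveSpace
open AlgebraicGeometry.Scheme.IdealSheafData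
open Summit.ResolutionOfSingularities.ResolutionOfSingularities.Cruxes.EquisingularLift.StrataSplit

namespace Summit.ResolutionOfSingularities.ResolutionOfSingularities.Cruxes.EquisingularLiftNat.Sections

namespace OneStep

variable (k : Type) [Field k] {m : ℕ} (F : MvPolynomial (Fin (m + 2 + 1)) k) {d : ℕ} (c : Fin (m + 2 + 1))

attribute [local instance] MvPolynomial.gradedAlgebra ProjBaseChange.algebraBase

/-! ## The vertex chart, transported to `ChartRing F c` -/

/-- **THE VERTEX CHART OF A ONE-STEP POINT, on `ChartRing F c`** (any vertex `c`): if `F(x_c := 1) = Φ + Ψ` (`Φ ≠ 0` a form of degree `μ`, `Ψ ∈ (y)^{μ+1}`,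
`(Φ + Ψ)` radical) and every explicit strict transform `G_l` passes the Jacobian criterion at the primes containing `T_l`, then for the centre
`I = (x_a/x_c : a ≠ c)` of `ChartRing F c` and `b = x_a/x_c` the localisations of `(ChartRing F c)[I/b]` at the primes containing `b` are regular —
`OneStep.isRegularLocalRing_localization_blowupAlgebra` transported along `ChartRing F c ≅ K[y]/(Φ + Ψ)` (`HypersurfaceSpecimen.exists_chartQuotEquiv`).
[cite: StacksProject, Tag 0BIQ] [cite: Matsumura1987, Thm. 14.2] -/
theorem isRegularLocalRing_localization_blowupAlgebra_chartRing (hF : F.IsHomogeneous d) {e : Fin 1 → Fin (m + 2 + 1)} (hec : ∀ j, e j = c)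
    (Φ Ψ : MvPolynomial (Fin (m + 2)) k) {μ : ℕ} (hΦ : Φ.IsHomogeneous μ) (hΦ0 : Φ ≠ 0)
    (hΨ : Ψ ∈ Ideal.span (Set.range (X : Fin (m + 2) → MvPolynomial (Fin (m + 2)) k)) ^ (μ + 1))
    (hdeh : dehomogenize k c F = Φ + Ψ) (hrad : (Ideal.span {Φ + Ψ}).radical = Ideal.span {Φ + Ψ})
    (hone : ∀ l : Fin (m + 2), ∃ G : MvPolynomial (Fin (m + 2)) k,
      aeval (fun j => X l * Function.update (X : Fin (m + 2) → MvPolynomial (Fin (m + 2)) k) l 1 j) (Φ + Ψ) = X l ^ μ * G ∧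
      ∀ P : Ideal (MvPolynomial (Fin (m + 2)) k), P.IsPrime → (X l : MvPolynomial (Fin (m + 2)) k) ∈ P → G ∈ P → ∃ j, pderiv j G ∉ P)
    (a : {a : Fin (m + 2 + 1) // a ∉ Set.range e})
    (𝔐 : Ideal (blowupAlgebra (Ideal.span (Set.range fun a' : {a' : Fin (m + 2 + 1) // a' ∉ Set.range e} => tautVec F c hF a'.1))
      (tautVec F c hF a.1))) [𝔐.IsPrime]
    (h𝔐 : algebraMap (ChartRing F c hF) (blowupAlgebra (Ideal.span (Set.range fun a' : {a' : Fin (m + 2 + 1) // a' ∉ Set.range e} =>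
      tautVec F c hF a'.1)) (tautVec F c hF a.1)) (tautVec F c hF a.1) ∈ 𝔐) :
    IsRegularLocalRing (Localization.AtPrime 𝔐) := by
  obtain ⟨θ, hθ⟩ := HypersurfaceSpecimen.exists_chartQuotEquiv F hF c (Φ + Ψ) hdeh hrad
  have hac : a.1 ≠ c := (OrdPointAt.not_mem_range_iff c hec a.1).mp a.2
  obtain ⟨l₀, hl₀⟩ : ∃ j : Fin (m + 2), c.succAbove j = a.1 := Fin.exists_succAbove_eq hac
  -- the centre and the generator under `θ`
  have hrange : Set.range (⇑θ.toRingHom ∘ fun a' : {a' : Fin (m + 2 + 1) // a' ∉ Set.range e} => tautVec F c hF a'.1) =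
      Set.range (⇑(Ideal.Quotient.mk (Ideal.span {Φ + Ψ})) ∘ (MvPolynomial.X : Fin (m + 2) → MvPolynomial (Fin (m + 2)) k)) := by
    ext q
    constructor
    · rintro ⟨⟨a', ha'⟩, rfl⟩
      obtain ⟨i, rfl⟩ : ∃ i : Fin (m + 2), c.succAbove i = a' :=
        Fin.exists_succAbove_eq ((OrdPointAt.not_mem_range_iff c hec a').mp ha')
      exact ⟨i, (hθ i).symm⟩
    · rintro ⟨i, rfl⟩
      exact ⟨⟨c.succAbove i, (OrdPointAt.not_mem_range_iff c hec _).mpr (Fin.succAbove_ne c i)⟩, hθ i⟩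
  have hIθ : (Ideal.span (Set.range fun a' : {a' : Fin (m + 2 + 1) // a' ∉ Set.range e} => tautVec F c hF a'.1)).map θ.toRingHom =
      (Ideal.span (Set.range (X : Fin (m + 2) → MvPolynomial (Fin (m + 2)) k))).map (Ideal.Quotient.mk (Ideal.span {Φ + Ψ})) := by
    rw [Ideal.map_span, Ideal.map_span, ← Set.range_comp, hrange, Set.range_comp]
  have hbθ : θ (tautVec F c hF a.1) = Ideal.Quotient.mk (Ideal.span {Φ + Ψ}) (X l₀) := by
    rw [← hl₀]
    exact hθ l₀
  -- the vertex chart statement for arbitrary indices equal to the transported ones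
  have key : ∀ (J : Ideal (MvPolynomial (Fin (m + 2)) k ⧸ Ideal.span {Φ + Ψ})) (b : MvPolynomial (Fin (m + 2)) k ⧸ Ideal.span {Φ + Ψ}),
      J = (Ideal.span (Set.range (X : Fin (m + 2) → MvPolynomial (Fin (m + 2)) k))).map (Ideal.Quotient.mk (Ideal.span {Φ + Ψ})) →
      b = Ideal.Quotient.mk (Ideal.span {Φ + Ψ}) (X l₀) →
      ∀ (𝔑 : Ideal (blowupAlgebra J b)) [𝔑.IsPrime], algebraMap _ (blowupAlgebra J b) b ∈ 𝔑 →
        IsRegularLocalRing (Localization.AtPrime 𝔑) := by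
    rintro J b rfl rfl 𝔑 _ h𝔑
    obtain ⟨G, hG, hjac⟩ := hone l₀
    exact OneStep.isRegularLocalRing_localization_blowupAlgebra k Φ Ψ hΦ hΦ0 hΨ l₀ G hG hjac 𝔑 h𝔑
  -- transport along `congrEquiv θ`
  let η := blowupAlgebra.congrEquiv θ (Ideal.span (Set.range fun a' : {a' : Fin (m + 2 + 1) // a' ∉ Set.range e} => tautVec F c hF a'.1))
    (tautVec F c hF a.1)
  obtain ⟨𝔑, h𝔑⟩ : ∃ P, P = 𝔐.comap η.symm.toRingHom := ⟨_, rfl⟩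
  haveI : 𝔑.IsPrime := by rw [h𝔑]; exact Ideal.comap_isPrime _ 𝔐
  have h𝔑mem : algebraMap _ (blowupAlgebra ((Ideal.span (Set.range fun a' : {a' : Fin (m + 2 + 1) // a' ∉ Set.range e} =>
      tautVec F c hF a'.1)).map θ.toRingHom) (θ (tautVec F c hF a.1))) (θ (tautVec F c hF a.1)) ∈ 𝔑 := by
    rw [h𝔑, Ideal.mem_comap]
    change η.symm _ ∈ 𝔐
    rw [blowupAlgebra.congrEquiv_symm_algebraMap, RingEquiv.symm_apply_apply]
    exact h𝔐
  have hreg := key _ _ hIθ hbθ 𝔑 h𝔑mem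
  exact OrdPoint.isRegularLocalRing_localization_of_ringEquiv
    (C := blowupAlgebra ((Ideal.span (Set.range fun a' : {a' : Fin (m + 2 + 1) // a' ∉ Set.range e} => tautVec F c hF a'.1)).map
      θ.toRingHom) (θ (tautVec F c hF a.1)))
    (D := blowupAlgebra (Ideal.span (Set.range fun a' : {a' : Fin (m + 2 + 1) // a' ∉ Set.range e} => tautVec F c hF a'.1))
      (tautVec F c hF a.1)) η.symm 𝔑 𝔐 (fun y => by rw [h𝔑, Ideal.mem_comap]; rfl) hreg

/-! ## Regularity of every blow-up of `H` along the point `P_c`, at the points over it -/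

/-- **A ONE-STEP POINT AT THE VERTEX `P_c` IS RESOLVED BY ONE BLOW-UP, POINTWISE** (any `n`, any `c`): `F` a prime form with `F(x_c := 1) = Φ + Ψ` as above
(`μ ≥ 1`) whose explicit strict transforms pass the Jacobian criterion along the exceptional divisor; `Λ_c = ker Proj(f_k)` the point `P_c`. Then for every
blow-up `ρ : Z → H = V₊(F)` along `Λ_c·𝒪_H` and every `z` with `ρ z ∈ supp(Λ_c·𝒪_H)` the local ring `𝒪_{Z,z}` is regular
(`HypersurfaceSpecimen.isRegularLocalRing_stalk_of_isBlowup_comap_of_mem_support` with the vertex chart above). [cite: StacksProject, Tag 0804] -/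
theorem isRegularLocalRing_stalk_of_isBlowup_comap (hF : F.IsHomogeneous d) (hFp : Prime F) {e : Fin 1 → Fin (m + 2 + 1)}
    (hec : ∀ j, e j = c)
    (fk : homogeneousSubmodule (Fin (m + 2 + 1)) k →+*ᵍ homogeneousSubmodule (Fin (0 + 1)) k)
    (hfk' : HomogeneousIdeal.irrelevant (homogeneousSubmodule (Fin (0 + 1)) k) ≤
      (HomogeneousIdeal.irrelevant (homogeneousSubmodule (Fin (m + 2 + 1)) k)).map fk)
    (hfkC : ∀ a : k, fk (C a) = C a) (hfke : ∀ j : Fin 1, fk (X (e j)) = X j)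
    (hfk0 : ∀ i : Fin (m + 2 + 1), i ∉ Set.range e → fk (X i) = 0)
    (Φ Ψ : MvPolynomial (Fin (m + 2)) k) {μ : ℕ} (hΦ : Φ.IsHomogeneous μ) (hμ : 1 ≤ μ) (hΦ0 : Φ ≠ 0)
    (hΨ : Ψ ∈ Ideal.span (Set.range (X : Fin (m + 2) → MvPolynomial (Fin (m + 2)) k)) ^ (μ + 1))
    (hdeh : dehomogenize k c F = Φ + Ψ)
    (hone : ∀ l : Fin (m + 2), ∃ G : MvPolynomial (Fin (m + 2)) k,
      aeval (fun j => X l * Function.update (X : Fin (m + 2) → MvPolynomial (Fin (m + 2)) k) l 1 j) (Φ + Ψ) = X l ^ μ * G ∧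
      ∀ P : Ideal (MvPolynomial (Fin (m + 2)) k), P.IsPrime → (X l : MvPolynomial (Fin (m + 2)) k) ∈ P → G ∈ P → ∃ j, pderiv j G ∉ P)
    {Z : Scheme.{0}} {ρ : Z ⟶ (hypersurface F).left} (hρ : IsBlowup ρ ((Proj.map fk hfk').ker.comap (hypersurfaceι F).left))
    (z : Z) (hz : ρ z ∈ (((Proj.map fk hfk').ker.comap (hypersurfaceι F).left).support : Set (hypersurface F).left)) :
    IsRegularLocalRing (Z.presheaf.stalk z) := by
  have hd : 0 < d := ConeN.pos_of_prime_of_isHomogeneous k F hF hFp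
  have he : Function.Injective e := Function.injective_of_subsingleton e
  have hrad := OrdPointAt.radical_span_dehomogenize_eq k F c hF hFp Φ Ψ hΦ hμ hΨ hdeh
  refine HypersurfaceSpecimen.isRegularLocalRing_stalk_of_isBlowup_comap_of_mem_support k F hF hd e he fk hfk' hfkC hfke hfk0
    (fun c' hc' a 𝔐 _ h𝔐 => ?_) hρ z hz
  obtain ⟨j, rfl⟩ := hc'
  have hec' : ∀ j', e j' = e j := fun j' => by rw [hec j', hec j]
  have hdeh' : dehomogenize k (e j) F = Φ + Ψ := by rw [hec j]; exact hdeh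
  exact isRegularLocalRing_localization_blowupAlgebra_chartRing k F (e j) hF hec' Φ Ψ hΦ hΦ0 hΨ hdeh' hrad hone a 𝔐 h𝔐


end OneStep

/-! ## EL♮ for hypersurfaces with one-step points at coordinate vertices -/

namespace OneStep

attribute [local instance] MvPolynomial.gradedAlgebra ProjBaseChange.algebraBase

/-- **EL♮ HOLDS FOR EVERY HYPERSURFACE WHOSE SINGULAR POINTS ARE ONE-STEP POINTS AT COORDINATE VERTICES, IN EVERY DIMENSION AND CHARACTERISTIC.**
`K` algebraically closed of characteristic `p`; `F ∈ K[x₀,…,x_{m+2}]` a prime form; `S` a duplicate-free list of coordinates such that for `c ∈ S`: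
`F(x_c := 1) = Φ + Ψ` with `Φ ≠ 0` a form of degree `μ ≥ 1`, `Ψ ∈ (y)^{μ+1}`, every explicit strict transform `G_l` (`(Φ+Ψ)(T_l, T_lT_j) = T_l^μ·G_l`)
passing the Jacobian criterion at the primes containing `T_l`, and the affine chart `F(x_c := 1)` singular at most at the origin; and such that the charts
`ChartRing F c`, `c ∉ S`, are regular. Then `Theorems.EquisingularLift.ELNatAt p K (m+2) H ι`: ONE blow-up of `ℙ^{m+2}_{𝕎(K)}` along the product of the
`𝕎(K)`-points through the `P_c` (`elNatAt_of_coordPointsKill`), exactly as T-MULTIORD with `OneStep.isRegularLocalRing_stalk_of_isBlowup_comap` at the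
marked vertices. Covers `A₂` points (`y₀y₁ + y₂³ + y₃² + ⋯`) besides the ordinary ones. [OURS · L1 W4.5b] [folklore] -/
theorem elNatAt_oneStepPoints (p : ℕ) (hp : p.Prime) (K : Type) [Field K] [CharP K p] [IsAlgClosed K] {m : ℕ}
    (F : MvPolynomial (Fin (m + 2 + 1)) K) {d : ℕ} (hF : F.IsHomogeneous d) (hFp : Prime F)
    (S : List (Fin (m + 2 + 1))) (hS : S.Nodup)
    (hone : ∀ c ∈ S, ∃ (μ : ℕ) (Φ Ψ : MvPolynomial (Fin (m + 2)) K), 1 ≤ μ ∧ Φ.IsHomogeneous μ ∧ Φ ≠ 0 ∧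
      Ψ ∈ Ideal.span (Set.range (X : Fin (m + 2) → MvPolynomial (Fin (m + 2)) K)) ^ (μ + 1) ∧ dehomogenize K c F = Φ + Ψ ∧
      ∀ l : Fin (m + 2), ∃ G : MvPolynomial (Fin (m + 2)) K,
        aeval (fun j => X l * Function.update (X : Fin (m + 2) → MvPolynomial (Fin (m + 2)) K) l 1 j) (Φ + Ψ) = X l ^ μ * G ∧
        ∀ P : Ideal (MvPolynomial (Fin (m + 2)) K), P.IsPrime → (X l : MvPolynomial (Fin (m + 2)) K) ∈ P → G ∈ P → ∃ j, pderiv j G ∉ P)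
    (hsing : ∀ c ∈ S, ∀ P : Ideal (MvPolynomial (Fin (m + 2)) K), P.IsPrime → dehomogenize K c F ∈ P →
      (∀ j, pderiv j (dehomogenize K c F) ∈ P) → ∀ j, (X j : MvPolynomial (Fin (m + 2)) K) ∈ P)
    (hoffS : ∀ c, c ∉ S → IsRegularRing (ChartRing F c hF)) :
    Theorems.EquisingularLift.ELNatAt p K (m + 2) (hypersurface F).left (hypersurfaceι F).left := by
  classical
  have hd : 0 < d := ConeN.pos_of_prime_of_isHomogeneous K F hF hFp
  have he : ∀ c : Fin (m + 2 + 1), Function.Injective (fun _ : Fin 1 => c) := fun c => Function.injective_of_subsingleton _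
  have hexk : ∀ c : Fin (m + 2 + 1), ∃ (g : homogeneousSubmodule (Fin (m + 2 + 1)) K →+*ᵍ homogeneousSubmodule (Fin (0 + 1)) K)
      (_ : HomogeneousIdeal.irrelevant (homogeneousSubmodule (Fin (0 + 1)) K) ≤
        (HomogeneousIdeal.irrelevant (homogeneousSubmodule (Fin (m + 2 + 1)) K)).map g),
      (∀ a : K, g (C a) = C a) ∧ (∀ j : Fin 1, g (X ((fun _ : Fin 1 => c) j)) = X j) ∧
        (∀ i : Fin (m + 2 + 1), i ∉ Set.range (fun _ : Fin 1 => c) → g (X i) = 0) := fun c =>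
    LinearCentre.exists_kill (R := K) (fun _ : Fin 1 => c) (he c)
  choose fk hfk' hfkC hfke hfk0 using hexk
  have hfke' : ∀ c (j : Fin 1), fk c (X c) = X j := fun c j => hfke c j
  have hfk0' : ∀ c (i : Fin (m + 2 + 1)), i ≠ c → fk c (X i) = 0 := fun c i hi => hfk0 c i (fun ⟨_, hj⟩ => hi hj.symm)
  have hec : ∀ c : Fin (m + 2 + 1), ∀ j : Fin 1, (fun _ : Fin 1 => c) j = c := fun _ _ => rfl
  haveI := HypersurfaceSpecimen.isIntegral_hypersurface_of_prime K F hF hFp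
  -- radicality of the chart equations at the marked vertices
  have hrad : ∀ c ∈ S, (Ideal.span {dehomogenize K c F}).radical = Ideal.span {dehomogenize K c F} := by
    intro c hc
    obtain ⟨μ, Φ, Ψ, hμ, hΦ, -, hΨ, hdeh, -⟩ := hone c hc
    rw [hdeh]
    exact OrdPointAt.radical_span_dehomogenize_eq K F c hF hFp Φ Ψ hΦ hμ hΨ hdeh
  refine elNatAt_of_coordPointsKill p hp K S hS _ (hypersurfaceι F).left fk hfk' hfkC hfke' hfk0' ?_ ?_ ?_
  · -- `supp Π Λ_c ⊆ ι(H)`: the marked vertices lie on `H`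
    intro y hy
    obtain ⟨c, hc, hyc⟩ := (CoordPoints.mem_support_prod_iff fk hfk' S y).mp hy
    obtain ⟨μ, Φ, Ψ, hμ, hΦ, -, hΨ, hdeh, -⟩ := hone c hc
    have hX : ∀ j : Fin (m + 2), (X (c.succAbove j) : MvPolynomial (Fin (m + 2 + 1)) K) ∈ y.asHomogeneousIdeal := fun j =>
      CoordPoints.X_mem_of_mem_support fk hfk' hfkC hfke' hfk0' hyc (Fin.succAbove_ne c j)
    refine (Set.ext_iff.mp (range_hypersurfaceι F) y).mpr ((ProjectiveSpectrum.mem_zeroLocus _ _ _).mpr (Set.singleton_subset_iff.mpr ?_))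
    change F ∈ y.asHomogeneousIdeal
    exact (Ideal.span_le.mpr (Set.range_subset_iff.mpr hX)) (OrdPointAt.mem_span_X_succAbove K F c hF Φ Ψ hΦ hμ hΨ hdeh)
  · -- `ι(H) ⊄ supp Π Λ_c`: the generic point of `H` is no vertex
    intro h
    have hmem : (pointOfPrime F hF hFp : Proj (homogeneousSubmodule (Fin (m + 2 + 1)) K)) ∈ Set.range (hypersurfaceι F).left := by
      refine (Set.ext_iff.mp (range_hypersurfaceι F) _).mpr ((ProjectiveSpectrum.mem_zeroLocus _ _ _).mpr (Set.singleton_subset_iff.mpr ?_))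
      exact Ideal.subset_span rfl
    obtain ⟨c, -, hyc⟩ := (CoordPoints.mem_support_prod_iff fk hfk' S _).mp (h hmem)
    obtain ⟨a, hac, ha⟩ := MultiOrd.exists_X_ne_not_mem_span K F hFp c
    exact ha (CoordPoints.X_mem_of_mem_support fk hfk' hfkC hfke' hfk0' hyc hac)
  · -- every blow-up of `H` along `Π Λ_c·𝒪_H` is regular
    intro Z ρ hρ
    rw [MultiCentre.comap_list_prod, List.map_map] at hρ
    refine MultiCentre.isRegular_of_prod _ ?_ ?_ ?_ hρ
    · -- pairwise disjoint supports
      rw [List.pairwise_map]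
      refine hS.pairwise_of_forall_ne fun c _ c' _ hcc' => ?_
      simp only [Function.comp_apply]
      rw [Set.disjoint_iff]
      rintro x ⟨hx, hx'⟩
      have h1 : (hypersurfaceι F).left x ∈ ((Proj.map (fk c) (hfk' c)).ker.support : Set (Proj (homogeneousSubmodule (Fin (m + 2 + 1)) K))) := by
        have h := hx; rwa [Scheme.IdealSheafData.support_comap] at h
      have h2 : (hypersurfaceι F).left x ∈ ((Proj.map (fk c') (hfk' c')).ker.support : Set (Proj (homogeneousSubmodule (Fin (m + 2 + 1)) K))) := by
        have h := hx'; rwa [Scheme.IdealSheafData.support_comap] at h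
      exact (CoordPoints.disjoint_support_ker fk hfk' hfkC hfke' hfk0' hcc').le_bot ⟨h1, h2⟩
    · -- each factor: an ordinary point, resolved pointwise; off it the blow-up is a local isomorphism
      intro I hI X₁ τ₁ hτ₁ z hz
      obtain ⟨c, hc, rfl⟩ := List.mem_map.mp hI
      simp only [Function.comp_apply] at hτ₁ hz ⊢
      by_cases hzs : τ₁ z ∈ ((((Proj.map (fk c) (hfk' c)).ker).comap (hypersurfaceι F).left).support : Set (hypersurface F).left)
      · obtain ⟨μ, Φ, Ψ, hμ, hΦ, hΦ0, hΨ, hdeh, hG⟩ := hone c hc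
        exact isRegularLocalRing_stalk_of_isBlowup_comap K F c hF hFp (hec c) (fk c) (hfk' c) (hfkC c) (hfke c) (hfk0 c)
          Φ Ψ hΦ hμ hΦ0 hΨ hdeh hG hτ₁ z hzs
      · rcases hz with hz | hz
        · exact absurd hz hzs
        · haveI := hτ₁.isIso_stalkMap_of_not_mem_support hzs
          haveI : IsRegularLocalRing ((hypersurface F).left.presheaf.stalk (τ₁ z)) := hz
          exact IsRegularLocalRing.of_ringEquiv (R := (hypersurface F).left.presheaf.stalk (τ₁ z)) (asIso (τ₁.stalkMap z)).commRingCatIsoToRingEquiv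
    · -- `H` is regular off the marked vertices
      intro x hx
      refine MultiOrd.isRegularLocalRing_stalk_of_forall_exists K F hF hd S (fun c hc => ⟨hrad c hc, hsing c hc⟩) hoffS x (fun c hc => ?_)
      have hxc : (hypersurfaceι F).left x ∉ ((Proj.map (fk c) (hfk' c)).ker.support : Set (Proj (homogeneousSubmodule (Fin (m + 2 + 1)) K))) := by
        intro h
        apply hx
        rw [IdealSheafData.coe_support_prod, Set.mem_iUnion₂]
        refine ⟨_, List.mem_map.mpr ⟨c, hc, rfl⟩, ?_⟩
        simp only [Function.comp_apply]
        rw [Scheme.IdealSheafData.support_comap]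
        exact h
      obtain ⟨a, ha, hXa⟩ := LinearCentre.exists_X_not_mem_of_not_mem_support (fun _ : Fin 1 => c) (he c) (fk c) (hfk' c) (hfkC c) (hfke c)
        (hfk0 c) hxc
      exact ⟨a, (OrdPointAt.not_mem_range_iff c (hec c) a).mp ha, (Proj.mem_basicOpen _ _ _).mpr hXa⟩


end OneStep

end Summit.ResolutionOfSingularities.ResolutionOfSingularities.Cruxes.EquisingularLiftNat.Sections

end
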